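/-
Copyright (c) 2026 the pub-hodgecm-mathlib formalisation cell (harness21).  Prover seat hodgecm-mathlib-K2E3-p03 (g4), Track B «K2-LIT» ∕ h413
(`stmt-HodgeConjecture-24833`), line `K2_E3_EllipticInputs`, unit U12, road «GL-[M6]-sc» (line lead K2E3-p23 (g5), deal (M3-2)), brick B2: THE FRAME FACTS
OF `G_Λ = GL₃(F) ⧸ Λ·1` — ITS CENTRE IS THE IMAGE OF THE CENTRE (HENCE COMPACT FOR `Λ` COCOMPACT), IT IS A NON-ARCHIMEDEAN GROUP, AND ITS HAAR MEASURES ARE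
INVERSION INVARIANT.  2026-09-04.
-/
import Summits.HodgeConjecture.HodgeConjecture.Theorems.K2E3GL3ModCocompactUnimodular   -- ★ (B0a-U) p857751 (K2E3-p23): `G_Λ` unimodular; brings ★ B0a `…ModCocompactCentral`, ★ GL-U∕GL-P
import Literature.NumberTheory.Automorphic.CongruenceSubgroupExpansionGL                -- ★ `nonarchimedeanGroup_gl` (`GL_n(F)` is a non-archimedean group)
import Literature.NumberTheory.Automorphic.GLnIwasawaIntegration                        -- ★ `isInvInvariant_of_isMulRightInvariant` (unimodular ⇒ inversion invariant)
import HarnessLib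

/-!
# K2_E3 road (h413), road «GL-[M6]-sc», brick B2 — frame facts of `G_Λ = GL₃(F) ⧸ Λ·1`: centre, non-archimedean structure, inversion invariance

Cell `pub/hodgecm-mathlib` (D-0151), Track B (21-frontier RULING «PUSH BOTH» 2026-09-03, director req624), seat K2E3-p03 (g4); by-name deal (M3-2) of the
line lead K2E3-p23 (g5), squad bus 2026-09-04T06:10:28Z.  `--supports stmt-HodgeConjecture-24833 --as helper`; THEOREMS ONLY (no definition ∕ instance ∕
notation ∕ named fact ∕ `sorry`); never imports `Cruxes/…/Lines`.  COUNT-NEUTRAL: the (S-D) socket stays OPEN; these are the `hZ` ∕ `[NonarchimedeanGroup]` ∕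
`[ν.IsInvInvariant]` inputs of ★ p856074 `smoothTrace_eq_integral_mul_of_truncatedOrbital_tendsto` at `G := G_Λ`.

THE RESULTS (`F` a non-archimedean local field in the `Valued F ℤᵐ⁰` frame of ★ B0a-U; `Λ₀ ≤ F^×` a subgroup, `Λ·1 := Λ₀.map (GL.scalar (Fin 3))`, which is central
hence normal ★ `normal_map_scalar`; `G_Λ := GL (Fin 3) F ⧸ Λ·1`, spelled out):
* **`center_quotScalar_eq`** (`CharZero F`) — `Z(G_Λ) = Z(GL₃(F))·Λ ∕ Λ`: the centre of `G_Λ` is the image of the centre (scalars) of `GL₃(F)`.  Proof: if `ḡ` is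
  central then for every transvection `T` one has `g T = T g s` with `s = c·1`, `c ∈ Λ₀`; taking traces of `g T g⁻¹ = T s` gives `3 = 3c`, so `c = 1` (characteristic
  zero) and `g` commutes with every transvection, hence is scalar (Mathlib `Matrix.mem_range_scalar_of_commute_transvectionStruct`);
* **`isCompact_center_quotScalar`** (`CharZero F`, `F^× ⧸ Λ₀` compact) — `Z(G_Λ)` is compact (★ B0a `isCompact_image_center`);
* **`nonarchimedeanGroup_quotient`** (any non-archimedean group, any normal subgroup) and **`nonarchimedeanGroup_quotScalar`** — `G_Λ` is a non-archimedean
  group (open subgroups `V·Λ∕Λ`, ★ `nonarchimedeanGroup_gl`);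
* **`isInvInvariant_quotScalar_of_isHaarMeasure`** (`Λ₀` closed) — every Haar measure on `G_Λ` is inversion invariant (unimodularity ★ B0a-U
  `isMulRightInvariant_quotScalar_of_isHaarMeasure` + ★ `isInvInvariant_of_isMulRightInvariant`).
[HarishChandra1970, Part VII §3 p. 70 (working modulo a cocompact central subgroup); Cartier1979, §I.3; DeitmarEchterhoff2014, Thm. 1.5.3]
HONEST LABEL: HC_CM is proved only modulo the 7 printed citations (2 remaining named inputs: hLiu418 = stmt-HodgeConjecture-24832, h413 =
stmt-HodgeConjecture-24833) until rung 0 closes; count-neutral helper.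

## References
* [HarishChandra1970] Harish-Chandra (notes by G. van Dijk), *Harmonic Analysis on Reductive p-adic Groups*, LNM 162 (1970), Part VII §3.
* [Cartier1979] P. Cartier, *Representations of p-adic groups: a survey*, Corvallis (1979), §I.3.
* [DeitmarEchterhoff2014] A. Deitmar, S. Echterhoff, *Principles of Harmonic Analysis*, 2nd ed. (2014), Thm. 1.5.3.
-/

set_option autoImplicit false
set_option linter.dupNamespace false   -- `Summit.HodgeConjecture.HodgeConjecture.…` (D-0017 nested layout; lakefile exemption for Summits)

noncomputable section

open MeasureTheory Measure Filter Topology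
open scoped MatrixGroups WithZero Valued
open Literature.NumberTheory.Automorphic
open Summit.HodgeConjecture.HodgeConjecture.Cruxes.H413.K2E3GL3ModCentre
open Summit.HodgeConjecture.HodgeConjecture.Cruxes.H413.K2E3GL3ModCocompactCentral
open Summit.HodgeConjecture.HodgeConjecture.Cruxes.H413.K2E3GL3ModCocompactUnimodular

namespace Summit.HodgeConjecture.HodgeConjecture.Cruxes.H413.K2E3GL3ModCocompactFrame

/-! ## §1  The centre of `G_Λ` (any field of characteristic zero) -/

section Centre

variable {F : Type*} [Field F]

/-- A transvection has trace `3` on `𝔤𝔩₃`. [folklore] -/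
theorem trace_transvectionStruct_toMatrix (t : Matrix.TransvectionStruct (Fin 3) F) : Matrix.trace t.toMatrix = 3 := by
  obtain ⟨i, j, hij, c⟩ := t
  rw [Matrix.TransvectionStruct.toMatrix_mk, Matrix.transvection, Matrix.trace_add, Matrix.trace_one, Fintype.card_fin]
  have h0 : Matrix.trace (Matrix.single i j c) = 0 := Matrix.trace_single_eq_of_ne i j c hij
  rw [h0]
  norm_num

/-- `tr (M · (c·1)) = c · tr M`. [folklore] -/
theorem trace_mul_coe_scalar (M : Matrix (Fin 3) (Fin 3) F) (c : Fˣ) :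
    Matrix.trace (M * (Matrix.GeneralLinearGroup.scalar (Fin 3) c : Matrix (Fin 3) (Fin 3) F)) = (c : F) * Matrix.trace M := by
  rw [Matrix.GeneralLinearGroup.coe_scalar, Matrix.scalar_apply, ← Matrix.smul_one_eq_diagonal, Matrix.mul_smul, Matrix.mul_one,
    Matrix.trace_smul, smul_eq_mul]

/-- The scalars `c·1` are central in `GL₃(F)`. [folklore] -/
theorem scalar_mem_center (c : Fˣ) : Matrix.GeneralLinearGroup.scalar (Fin 3) c ∈ Subgroup.center (GL (Fin 3) F) := by
  rw [Matrix.GeneralLinearGroup.center_eq_range_scalar]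
  exact ⟨c, rfl⟩

/-- **The centre of `G_Λ = GL₃(F) ⧸ Λ·1` is the image of the centre of `GL₃(F)`** (`F` of characteristic zero; `Λ·1` the image of any `Λ₀ ≤ F^×`).
If `ḡ` is central, then for every transvection `T`: `g T = T g · (c·1)` with `c ∈ Λ₀`; traces of `g T g⁻¹ = T·(c·1)` give `3 = 3c`, so `c = 1`, `g` commutes
with every transvection and is scalar. [cite: HarishChandra1970, Part VII §3 p. 70] -/
theorem center_quotScalar_eq [CharZero F] (Λ₀ : Subgroup Fˣ) [(Λ₀.map (Matrix.GeneralLinearGroup.scalar (Fin 3))).Normal] :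
    Subgroup.center (GL (Fin 3) F ⧸ Λ₀.map (Matrix.GeneralLinearGroup.scalar (Fin 3))) =
      (Subgroup.center (GL (Fin 3) F)).map (QuotientGroup.mk' (Λ₀.map (Matrix.GeneralLinearGroup.scalar (Fin 3)))) := by
  ext x
  constructor
  · intro hx
    obtain ⟨g, rfl⟩ := QuotientGroup.mk_surjective x
    refine Subgroup.mem_map.2 ⟨g, ?_, rfl⟩
    rw [Matrix.GeneralLinearGroup.mem_center_iff_val_mem_range_scalar]
    refine Matrix.mem_range_scalar_of_commute_transvectionStruct fun t => ?_
    -- the transvection as an element of `GL₃(F)`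
    let T : GL (Fin 3) F := ⟨t.toMatrix, t.inv.toMatrix, t.mul_inv, t.inv_mul⟩
    have hTval : (T : Matrix (Fin 3) (Fin 3) F) = t.toMatrix := rfl
    -- `mk T` commutes with the central `mk g`: `(T g)⁻¹ (g T) ∈ Λ·1`
    have hcomm : (QuotientGroup.mk (T * g) : GL (Fin 3) F ⧸ Λ₀.map (Matrix.GeneralLinearGroup.scalar (Fin 3))) = QuotientGroup.mk (g * T) := by
      rw [QuotientGroup.mk_mul, QuotientGroup.mk_mul]
      exact (Subgroup.mem_center_iff.1 hx (QuotientGroup.mk T : GL (Fin 3) F ⧸ Λ₀.map (Matrix.GeneralLinearGroup.scalar (Fin 3))))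
    rw [QuotientGroup.eq] at hcomm
    obtain ⟨c, -, hs⟩ := Subgroup.mem_map.1 hcomm
    -- `g T = T g (c·1)` and `g T g⁻¹ = T (c·1)`
    have hgT : g * T = T * g * Matrix.GeneralLinearGroup.scalar (Fin 3) c := by
      rw [hs, mul_inv_cancel_left]
    have hconj : g * T * g⁻¹ = T * Matrix.GeneralLinearGroup.scalar (Fin 3) c := by
      rw [hgT, mul_assoc T g, Subgroup.mem_center_iff.1 (scalar_mem_center c) g, ← mul_assoc, mul_inv_cancel_right]
    -- traces: `3 = c · 3`
    have htr : (3 : F) = (c : F) * 3 := by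
      have h := congrArg (fun u : GL (Fin 3) F => Matrix.trace (u : Matrix (Fin 3) (Fin 3) F)) hconj
      simp only [Units.val_mul] at h
      rw [Matrix.trace_units_conj, trace_mul_coe_scalar, hTval, trace_transvectionStruct_toMatrix] at h
      exact h
    have hc1 : (c : F) = 1 := by
      have h3 : (3 : F) ≠ 0 := by norm_num
      have h' : ((c : F) - 1) * 3 = 0 := by rw [sub_mul, one_mul, ← htr, sub_self]
      rcases mul_eq_zero.1 h' with h0 | h0
      · exact sub_eq_zero.1 h0
      · exact absurd h0 h3
    have hc1' : c = 1 := Units.val_eq_one.1 hc1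
    rw [hc1', map_one, mul_one] at hgT
    -- `g` commutes with the transvection
    have hval := congrArg (fun u : GL (Fin 3) F => (u : Matrix (Fin 3) (Fin 3) F)) hgT
    simp only [Units.val_mul, hTval] at hval
    exact hval.symm
  · intro hx
    obtain ⟨g, hg, rfl⟩ := Subgroup.mem_map.1 hx
    rw [Subgroup.mem_center_iff]
    intro y
    obtain ⟨h, rfl⟩ := QuotientGroup.mk_surjective y
    change (QuotientGroup.mk h : GL (Fin 3) F ⧸ Λ₀.map (Matrix.GeneralLinearGroup.scalar (Fin 3))) * QuotientGroup.mk g =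
      QuotientGroup.mk g * QuotientGroup.mk h
    rw [← QuotientGroup.mk_mul, ← QuotientGroup.mk_mul, (Subgroup.mem_center_iff.1 hg) h]

end Centre

/-! ## §2  Compactness of the centre of `G_Λ` for `Λ` cocompact -/

section CompactCentre

variable {F : Type*} [Field F] [TopologicalSpace F]

/-- **`Z(G_Λ)` is compact** when `F^× ⧸ Λ₀` is compact (`F` of characteristic zero): by §1 it is the continuous image of `Z(GL₃(F)) ≅ F^×` through `F^× ⧸ Λ₀`
(★ B0a `isCompact_image_center`). [cite: HarishChandra1970, Part VII §3 p. 70] -/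
theorem isCompact_center_quotScalar [CharZero F] (Λ₀ : Subgroup Fˣ) [(Λ₀.map (Matrix.GeneralLinearGroup.scalar (Fin 3))).Normal] [CompactSpace (Fˣ ⧸ Λ₀)] :
    IsCompact ((Subgroup.center (GL (Fin 3) F ⧸ Λ₀.map (Matrix.GeneralLinearGroup.scalar (Fin 3))) :
      Set (GL (Fin 3) F ⧸ Λ₀.map (Matrix.GeneralLinearGroup.scalar (Fin 3))))) := by
  rw [center_quotScalar_eq Λ₀, Subgroup.coe_map]
  exact isCompact_image_center Λ₀

end CompactCentre

/-! ## §3  `G_Λ` is a non-archimedean group -/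

section Nonarchimedean

/-- **A quotient of a non-archimedean group by a normal subgroup is non-archimedean**: the images `V·N ∕ N` of the open subgroups `V` form a basis of open
subgroups (the quotient map is open). [folklore] -/
theorem nonarchimedeanGroup_quotient {G : Type*} [Group G] [TopologicalSpace G] [NonarchimedeanGroup G] (N : Subgroup G) [N.Normal] :
    NonarchimedeanGroup (G ⧸ N) :=
  { (inferInstance : IsTopologicalGroup (G ⧸ N)) with
    is_nonarchimedean := fun U hU => by
      have hU' : (QuotientGroup.mk : G → G ⧸ N) ⁻¹' U ∈ 𝓝 (1 : G) :=
        QuotientGroup.continuous_mk.continuousAt.preimage_mem_nhds (by rwa [QuotientGroup.mk_one])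
      obtain ⟨V, hV⟩ := NonarchimedeanGroup.is_nonarchimedean _ hU'
      refine ⟨⟨(V : Subgroup G).map (QuotientGroup.mk' N), ?_⟩, ?_⟩
      · change IsOpen ((QuotientGroup.mk' N) '' (V : Set G))
        exact QuotientGroup.isOpenMap_coe _ V.isOpen
      · intro y hy
        obtain ⟨v, hv, rfl⟩ := Subgroup.mem_map.1 hy
        exact hV hv }

variable {F : Type*} [Field F] [ValuativeRel F] [TopologicalSpace F] [IsNonarchimedeanLocalField F]

/-- **`G_Λ = GL₃(F) ⧸ Λ·1` is a non-archimedean group** (★ `nonarchimedeanGroup_gl` + `nonarchimedeanGroup_quotient`). [cite: Cartier1979, §I.3] -/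
theorem nonarchimedeanGroup_quotScalar (Λ₀ : Subgroup Fˣ) [(Λ₀.map (Matrix.GeneralLinearGroup.scalar (Fin 3))).Normal] :
    NonarchimedeanGroup (GL (Fin 3) F ⧸ Λ₀.map (Matrix.GeneralLinearGroup.scalar (Fin 3))) := by
  haveI : NonarchimedeanGroup (GL (Fin 3) F) := nonarchimedeanGroup_gl F 3
  exact nonarchimedeanGroup_quotient _

end Nonarchimedean

/-! ## §4  Haar measures on `G_Λ` are inversion invariant -/

section InvInvariant

variable {F : Type*} [Field F] [Valued F ℤᵐ⁰] [ValuativeRel F] [(Valued.v : Valuation F ℤᵐ⁰).Compatible] [IsNonarchimedeanLocalField F]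
  (Λ₀ : Subgroup Fˣ) [(Λ₀.map (Matrix.GeneralLinearGroup.scalar (Fin 3))).Normal]
  [MeasurableSpace (GL (Fin 3) F ⧸ Λ₀.map (Matrix.GeneralLinearGroup.scalar (Fin 3)))] [BorelSpace (GL (Fin 3) F ⧸ Λ₀.map (Matrix.GeneralLinearGroup.scalar (Fin 3)))]

/-- **Every Haar measure on `G_Λ = GL₃(F) ⧸ Λ·1` is inversion invariant** (`Λ₀` closed): `G_Λ` is unimodular (★ B0a-U
`isMulRightInvariant_quotScalar_of_isHaarMeasure`), and a right invariant Haar measure on a second countable locally compact group is inversion invariant (★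
`isInvInvariant_of_isMulRightInvariant`). [cite: DeitmarEchterhoff2014, Thm. 1.5.3] [cite: Cartier1979, §I.3] -/
theorem isInvInvariant_quotScalar_of_isHaarMeasure (hΛ : IsClosed (Λ₀ : Set Fˣ)) {ϖ : F} (hϖ : Valued.v ϖ = WithZero.exp (-1 : ℤ))
    (μ : Measure (GL (Fin 3) F ⧸ Λ₀.map (Matrix.GeneralLinearGroup.scalar (Fin 3)))) [μ.IsHaarMeasure] : μ.IsInvInvariant := by
  haveI : SecondCountableTopology (GL (Fin 3) F) := secondCountableTopology_gl3 F
  haveI : LocallyCompactSpace (GL (Fin 3) F) := locallyCompactSpace_gl3 F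
  haveI : T2Space (GL (Fin 3) F ⧸ Λ₀.map (Matrix.GeneralLinearGroup.scalar (Fin 3))) := t2Space_quotScalar Λ₀ hΛ
  haveI : μ.IsMulRightInvariant := isMulRightInvariant_quotScalar_of_isHaarMeasure Λ₀ hΛ hϖ μ
  exact Literature.NumberTheory.Automorphic.isInvInvariant_of_isMulRightInvariant μ

end InvInvariant

end Summit.HodgeConjecture.HodgeConjecture.Cruxes.H413.K2E3GL3ModCocompactFrame

end
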